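import Literature.AlgebraicGeometry.Resolution.KiralyLutkebohmertCriterion
import Literature.AlgebraicGeometry.Resolution.KiralyLutkebohmert
import Literature.AlgebraicGeometry.Resolution.RegularLocalRingsFlatDescent
import Literature.RingTheory.RegularLocalRing.KiralyLutkebohmert
import HarnessLib

/-!
# Király–Lütkebohmert's criterion, Theorem 2 first part — discharge of
# `KiralyLutkebohmert2013_thm2_first`

`Literature.AlgebraicGeometry.Resolution.KiralyLutkebohmert2013_thm2_first` (file
`KiralyLutkebohmertCriterion`) is the named fact: for a Noetherian normal local domain `B`, a prime
`p` and a ring automorphism `σ ≠ 1` with `σ ^ p = 1`, writing `A = B^σ` for the ring of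
invariants and `I_G = (σ b - b ; b ∈ B)` for the augmentation ideal,
(a) `I_G` principal ⟺ (b) `B = A[y]` monogenous, and (b) ⟹ (c) `B` is a free `A`-module
(Király–Lütkebohmert, *Group actions of prime order on local normal rings*, Algebra & Number Theory
7 (2013), Thm. 2, first part, with its proof on pp. 64–68 = arXiv:1001.1945 pp. 1–4).

This file PROVES it (`KiralyLutkebohmert2013_thm2_first_holds`), following the printed proof:

* (a) ⟹ (b) is Proposition 5 of the paper, already formalised in
  `Literature.RingTheory.RegularLocalRing.KiralyLutkebohmert` for every local domain
  (`KiralyLutkebohmert2013.exists_augGen`, `KiralyLutkebohmert2013.adjoin_eq_top_of_augIdeal`);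
* (b) ⟹ (a): if `B = A[y]` then `σ(q(y)) - q(y) = q(σ y) - q(y)` is a multiple of `σ y - y` for
  every `q ∈ A[T]`, so `I_G = (σ y - y)` (`augIdeal_eq_span_of_adjoin_eq_top`; the paper's
  "(b) → (a) is trivial");
* (b) ⟹ (c): then `y` is an augmentation generator, so by Proposition 5 every `b` is
  `Σ_{i<p} e_i yⁱ` with `e_i ∈ A` (`KiralyLutkebohmert2013.exists_eq_sum_of_augIdeal`), and the
  representation is unique because a polynomial of degree `< p` over the domain `B` vanishing at
  the `p` distinct conjugates `σᵏ y` (`KiralyLutkebohmert2013.pow_apply_injective`) is zero; hence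
  `1, y, …, y^{p-1}` is an `A`-basis of `B` (`module_free_of_adjoin_eq_top`), which is the printed
  `B = ⊕_{i<p} A yⁱ`.

Only "local domain" is used (the hypotheses "Noetherian" and "integrally closed" of the vendored
statement are not needed for the first part, exactly as in the paper, whose first part is stated
for normal local rings and proved with the domain property only).

It also PROVES the second part, `KiralyLutkebohmert2013_thm2_second_holds` ((c) ⟹ (d) for regular
`B`), exactly along the printed proof ("`B` is noetherian … Since `A → B` is faithfully flat, so `A`
is noetherian", then [Matsumura, Thm. 23.7]): the ring of invariants `A` is local and `A → B` is a
local homomorphism (a unit of `B` lying in `A` has a `σ`-fixed inverse,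
`isUnit_invariants_of_isUnit`), a free module over a local ring along a local map is faithfully
flat (Mathlib `Module.FaithfullyFlat.of_flat_of_isLocalHom`), Noetherianity descends (Mathlib
`IsNoetherian.of_isNoetherian_tensorProduct_of_faithfullyFlat`), and Matsumura 23.7 (i) is the
tree theorem `IsRegularLocalRing.of_flat_of_isLocalHom` (`RegularLocalRingsFlatDescent.lean`).
Chaining both parts with Proposition 5 discharges the older vendored form
`KiralyLutkebohmertRegularity` of `Literature/AlgebraicGeometry/Resolution/KiralyLutkebohmert.lean`
((a) ⟹ (c) ∧ (d) for regular `B`, `KiralyLutkebohmertRegularity_holds`). No new named facts.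

## References

* [KiralyLutkebohmert2013] F. Király, W. Lütkebohmert, *Group actions of prime order on local
  normal rings*, Algebra & Number Theory 7:1 (2013) 63–74, Theorem 2 and Proposition 5.
-/

namespace Literature.AlgebraicGeometry.Resolution

open Polynomial Finset
open scoped TensorProduct
open Literature.RingTheory.RegularLocalRing

universe u

variable {B : Type u} [CommRing B]

/-- The augmentation ideal of `AugmentationIdeal.lean` is the one of the Proposition-5 file
(both are `(σ b - b ; b ∈ B)`). [cite: KiralyLutkebohmert2013, §1 p. 64] -/
theorem augIdeal_eq_KL (σ : B ≃+* B) : augIdeal σ = KiralyLutkebohmert2013.augIdeal σ := rfl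

/-- **Theorem 2, (b) ⟹ (a)** ("trivial" in the paper): if `B = A[y]` over the invariants `A = B^σ`,
then the augmentation ideal is generated by `σ y - y`, since `σ (q(y)) - q(y) = q(σ y) - q(y)` is
divisible by `σ y - y` for `q ∈ A[T]`. [cite: KiralyLutkebohmert2013, Thm. 2 (b)⟹(a), p. 64] -/
theorem augIdeal_eq_span_of_adjoin_eq_top (σ : B ≃+* B) {y : B}
    (hy : Algebra.adjoin ((σ : B →+* B).eqLocus (RingHom.id B)) ({y} : Set B) = ⊤) :
    augIdeal σ = Ideal.span {σ y - y} := by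
  apply le_antisymm
  · rw [augIdeal_def, Ideal.span_le]
    rintro _ ⟨b, rfl⟩
    have hb : b ∈ Algebra.adjoin ((σ : B →+* B).eqLocus (RingHom.id B)) ({y} : Set B) := by
      rw [hy]; exact Algebra.mem_top
    rw [Algebra.adjoin_singleton_eq_range_aeval] at hb
    obtain ⟨q, rfl⟩ := hb
    have hc : (σ : B →+* B).comp (algebraMap ((σ : B →+* B).eqLocus (RingHom.id B)) B) =
        algebraMap ((σ : B →+* B).eqLocus (RingHom.id B)) B := RingHom.ext fun a => a.2
    have h1 : σ (aeval y q) = aeval (σ y) q := by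
      rw [aeval_def, aeval_def]
      show (σ : B →+* B) (eval₂ (algebraMap _ B) y q) = _
      rw [hom_eval₂, hc]
      rfl
    show σ (aeval y q) - aeval y q ∈ Ideal.span {σ y - y}
    rw [Ideal.mem_span_singleton, h1, aeval_def, aeval_def, ← eval_map, ← eval_map]
    exact sub_dvd_eval_sub _ _ _
  · rw [Ideal.span_le, Set.singleton_subset_iff]
    exact Ideal.subset_span ⟨y, rfl⟩

/-- Invariants are fixed by all powers of `σ`. [cite: KiralyLutkebohmert2013, §1 p. 64] -/
theorem pow_apply_of_apply_eq (σ : B ≃+* B) {a : B} (ha : σ a = a) (k : ℕ) : (σ ^ k) a = a := by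
  induction k with
  | zero => rfl
  | succ k ih => rw [pow_succ, RingAut.mul_apply, ha, ih]

/-- **Theorem 2, (b) ⟹ (c), with Proposition 5's `B = ⊕_{i<p} A yⁱ`**: if `B = A[y]` over the
invariants `A` of an automorphism `σ ≠ 1` of prime order `p` of a local domain `B`, then
`1, y, …, y^{p-1}` is an `A`-basis of `B`; in particular `B` is a free `A`-module. Existence of
the representation is Proposition 5 (`exists_eq_sum_of_augIdeal`, `y` being an augmentation
generator by (b) ⟹ (a)); uniqueness: a polynomial of degree `< p` over `B` vanishing at the `p`
distinct conjugates `σᵏ y` is zero. [cite: KiralyLutkebohmert2013, Thm. 2 (b)⟹(c) and Prop. 5] -/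
theorem module_free_of_adjoin_eq_top [IsDomain B] [IsLocalRing B] {p : ℕ} (hp : p.Prime)
    (σ : B ≃+* B) (hσ : σ ≠ RingEquiv.refl B) (hσp : σ ^ p = RingEquiv.refl B) {y : B}
    (hy : Algebra.adjoin ((σ : B →+* B).eqLocus (RingHom.id B)) ({y} : Set B) = ⊤) :
    Module.Free ((σ : B →+* B).eqLocus (RingHom.id B)) B := by
  classical
  set A := (σ : B →+* B).eqLocus (RingHom.id B) with hAdef
  have hI : KiralyLutkebohmert2013.augIdeal σ = Ideal.span {σ y - y} := by
    rw [← augIdeal_eq_KL]; exact augIdeal_eq_span_of_adjoin_eq_top σ hy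
  have hσ' : σ ≠ 1 := hσ
  have hσp' : σ ^ p = 1 := hσp
  -- the candidate basis `yⁱ`, `i < p`
  let v : Fin p → B := fun j => y ^ (j : ℕ)
  -- spanning (Proposition 5)
  have hsp : ⊤ ≤ Submodule.span A (Set.range v) := by
    intro b _
    obtain ⟨e, he, hb⟩ := KiralyLutkebohmert2013.exists_eq_sum_of_augIdeal hσ' hp hσp' hI b
    rw [hb]
    refine Submodule.sum_mem _ fun j _ => ?_
    have heA : e j ∈ A := by
      rw [hAdef, RingHom.mem_eqLocus, RingHom.id_apply, RingEquiv.coe_toRingHom]; exact he j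
    have hsm : e j * y ^ (j : ℕ) = (⟨e j, heA⟩ : A) • v j := rfl
    rw [hsm]
    exact Submodule.smul_mem _ _ (Submodule.subset_span ⟨j, rfl⟩)
  -- independence
  have hli : LinearIndependent A v := by
    rw [Fintype.linearIndependent_iff]
    intro g hg
    -- the polynomial `P = Σ g_i T^i ∈ B[T]` of degree `< p`
    set P : B[X] := ∑ i : Fin p, C ((g i : B)) * X ^ (i : ℕ) with hP
    have hPdeg : P.natDegree < p := by
      have h1 : P.natDegree ≤ p - 1 := by
        rw [hP]
        exact natDegree_sum_le_of_forall_le _ _ fun i _ =>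
          (natDegree_C_mul_X_pow_le _ _).trans (by have := i.2; omega)
      have := hp.one_lt; omega
    -- `P` vanishes at every conjugate `σᵏ y`
    have hPeval : ∀ k : Fin p, P.eval ((σ ^ (k : ℕ)) y) = 0 := by
      intro k
      have h0 : (σ ^ (k : ℕ)) (∑ i : Fin p, (g i : B) * y ^ (i : ℕ)) = 0 := by
        have : ∑ i : Fin p, (g i : B) * y ^ (i : ℕ) = ∑ i : Fin p, g i • v i := rfl
        rw [this, hg, map_zero]
      rw [map_sum] at h0
      rw [hP, eval_finsetSum, ← h0]
      refine sum_congr rfl fun i _ => ?_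
      rw [eval_mul, eval_C, eval_pow, eval_X, map_mul, map_pow,
        pow_apply_of_apply_eq σ (a := (g i : B)) (g i).2 k]
    have hinj : Function.Injective fun k : Fin p => (σ ^ (k : ℕ)) y := by
      intro k k' hkk'
      exact Fin.ext (KiralyLutkebohmert2013.pow_apply_injective hσ' hp hσp' hI k.2 k'.2 hkk')
    have hP0 : P = 0 :=
      eq_zero_of_natDegree_lt_card_of_eval_eq_zero P hinj hPeval (by simpa using hPdeg)
    -- read off the coefficients
    intro i
    have hc : P.coeff (i : ℕ) = (g i : B) := by
      rw [hP, finsetSum_coeff]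
      simp only [coeff_C_mul_X_pow]
      rw [Finset.sum_eq_single i]
      · simp
      · intro j _ hji
        rw [if_neg]
        exact fun h => hji (Fin.ext h.symm)
      · intro hi; exact absurd (mem_univ i) hi
    rw [hP0, coeff_zero] at hc
    exact Subtype.ext (by simpa using hc.symm)
  exact Module.Free.of_basis (Module.Basis.mk hli hsp)

/-- **Discharge of `KiralyLutkebohmert2013_thm2_first` (Király–Lütkebohmert 2013, Theorem 2, first
part: (a) ⟺ (b) ⟹ (c)).** (a) ⟹ (b) is Proposition 5 (`exists_augGen`,
`adjoin_eq_top_of_augIdeal` of `Literature.RingTheory.RegularLocalRing.KiralyLutkebohmert`);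
(b) ⟹ (a) is `augIdeal_eq_span_of_adjoin_eq_top`; (b) ⟹ (c) is `module_free_of_adjoin_eq_top`.
[cite: KiralyLutkebohmert2013, Thm. 2 (first part) and Prop. 5, pp. 64–68] -/
theorem KiralyLutkebohmert2013_thm2_first_holds : KiralyLutkebohmert2013_thm2_first := by
  intro B _ _ _ _ _ p hp σ hσ hσp
  have hσ' : σ ≠ 1 := hσ
  have hσp' : σ ^ p = 1 := hσp
  refine ⟨⟨fun hP => ?_, ?_⟩, ?_⟩
  · obtain ⟨y, hy⟩ := KiralyLutkebohmert2013.exists_augGen (σ := σ) hσ' hP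
    exact ⟨y, KiralyLutkebohmert2013.adjoin_eq_top_of_augIdeal hσ' hp hσp' hy⟩
  · rintro ⟨y, hy⟩
    rw [augIdeal_eq_span_of_adjoin_eq_top σ hy]
    exact ⟨⟨σ y - y, rfl⟩⟩
  · rintro ⟨y, hy⟩
    exact module_free_of_adjoin_eq_top hp σ hσ hσp hy

/-! ## Theorem 2, second part: (c) ⟹ (d) -/

/-- A unit of `B` lying in the ring of invariants `A = B^σ` is a unit of `A`: its inverse is
`σ`-fixed. [cite: KiralyLutkebohmert2013, Thm. 2, proof of the second part (p. 68)] -/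
theorem isUnit_invariants_of_isUnit (σ : B ≃+* B)
    {a : (σ : B →+* B).eqLocus (RingHom.id B)} (ha : IsUnit (a : B)) : IsUnit a := by
  obtain ⟨u, hu⟩ := ha
  have hfix : σ (a : B) = a := a.2
  have hinv : σ (↑u⁻¹ : B) = ↑u⁻¹ := by
    have h1 : σ (↑u⁻¹ : B) * (u : B) = 1 := by
      conv_lhs => rw [hu, ← hfix, ← map_mul, ← hu, Units.inv_mul, map_one]
    exact (Units.inv_eq_of_mul_eq_one_left h1).symm
  refine isUnit_iff_exists_inv.2 ⟨⟨(↑u⁻¹ : B), ?_⟩, Subtype.ext ?_⟩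
  · rw [RingHom.mem_eqLocus, RingHom.id_apply, RingEquiv.coe_toRingHom]; exact hinv
  · show (a : B) * ↑u⁻¹ = 1
    rw [← hu, Units.mul_inv]

/-- The ring of invariants of an automorphism of a local ring is local.
[cite: KiralyLutkebohmert2013, Thm. 2, proof of the second part (p. 68)] -/
theorem isLocalRing_invariants [IsLocalRing B] (σ : B ≃+* B) :
    IsLocalRing ((σ : B →+* B).eqLocus (RingHom.id B)) := by
  refine IsLocalRing.of_isUnit_or_isUnit_one_sub_self fun a => ?_
  rcases IsLocalRing.isUnit_or_isUnit_one_sub_self (a : B) with h | h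
  · exact Or.inl (isUnit_invariants_of_isUnit σ h)
  · refine Or.inr (isUnit_invariants_of_isUnit σ ?_)
    simpa using h

/-- The inclusion of the ring of invariants is a local homomorphism.
[cite: KiralyLutkebohmert2013, Thm. 2, proof of the second part (p. 68)] -/
theorem isLocalHom_algebraMap_invariants (σ : B ≃+* B) :
    IsLocalHom (algebraMap ((σ : B →+* B).eqLocus (RingHom.id B)) B) :=
  ⟨fun _ ha => isUnit_invariants_of_isUnit σ ha⟩

/-- **Discharge of `KiralyLutkebohmert2013_thm2_second` (Király–Lütkebohmert 2013, Theorem 2,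
second part: (c) ⟹ (d)).** If the regular local ring `B` is free over the invariants `A` of `σ`,
then `A → B` is a flat local homomorphism of local rings, hence faithfully flat, so `A` is
Noetherian (faithfully flat descent) and regular by Matsumura 23.7 (i)
(`IsRegularLocalRing.of_flat_of_isLocalHom`). [cite: KiralyLutkebohmert2013, Thm. 2 (second part), p. 68] -/
theorem KiralyLutkebohmert2013_thm2_second_holds : KiralyLutkebohmert2013_thm2_second := by
  intro B _ _ p _ σ _ _ hfree
  haveI := hfree
  haveI : IsLocalRing ((σ : B →+* B).eqLocus (RingHom.id B)) := isLocalRing_invariants σ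
  haveI : IsLocalHom (algebraMap ((σ : B →+* B).eqLocus (RingHom.id B)) B) :=
    isLocalHom_algebraMap_invariants σ
  haveI : Module.FaithfullyFlat ((σ : B →+* B).eqLocus (RingHom.id B)) B :=
    Module.FaithfullyFlat.of_flat_of_isLocalHom
  haveI : IsNoetherianRing ((σ : B →+* B).eqLocus (RingHom.id B)) := by
    have h : IsNoetherian B (B ⊗[(σ : B →+* B).eqLocus (RingHom.id B)]
        ((σ : B →+* B).eqLocus (RingHom.id B))) :=
      isNoetherian_of_linearEquiv (TensorProduct.AlgebraTensorModule.rid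
        ((σ : B →+* B).eqLocus (RingHom.id B)) B B).symm
    exact Submodule.IsNoetherian.of_isNoetherian_tensorProduct_of_faithfullyFlat h
  exact IsRegularLocalRing.of_flat_of_isLocalHom _ B

/-! ## The chained criterion for regular `B` -/

/-- Powers of a ring automorphism act by iteration. [folklore] -/
private theorem ringAut_pow_apply (σ : B ≃+* B) (n : ℕ) (b : B) : (σ ^ n) b = (⇑σ)^[n] b := by
  induction n generalizing b with
  | zero => rfl
  | succ n ih => rw [pow_succ, RingAut.mul_apply, ih, Function.iterate_succ_apply]

/-- **Discharge of `KiralyLutkebohmertRegularity`** (Király–Lütkebohmert 2013, Theorem 2,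
(a) ⟹ (b) ⟹ (c) ⟹ (d) for a regular local ring): a principal augmentation ideal makes `B` free over
the invariants `B^σ` and `B^σ` regular. Regular local rings are normal domains
(`isDomain_of_isRegularLocalRing`, `isIntegrallyClosed_of_isRegularLocalRing`), so both parts of
Theorem 2 apply. [cite: KiralyLutkebohmert2013, Thm. 2 ((a) ⟹ (b) ⟹ (c) ⟹ (d)), pp. 63–68] -/
theorem KiralyLutkebohmertRegularity_holds : KiralyLutkebohmertRegularity := by
  intro B _ _ p σ hp hiter hσ hP
  have hσp : σ ^ p = RingEquiv.refl B := by
    ext b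
    rw [ringAut_pow_apply, hiter b]
    rfl
  haveI : IsDomain B := isDomain_of_isRegularLocalRing B
  haveI : IsIntegrallyClosed B := isIntegrallyClosed_of_isRegularLocalRing B
  obtain ⟨hab, hbc⟩ := KiralyLutkebohmert2013_thm2_first_holds B p hp σ hσ hσp
  have hc : Module.Free ((σ : B →+* B).eqLocus (RingHom.id B)) B := hbc (hab.1 hP)
  exact ⟨KiralyLutkebohmert2013_thm2_second_holds B p hp σ hσ hσp hc, hc⟩

end Literature.AlgebraicGeometry.Resolution
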